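import Literature.Analysis.FluidPDE.DivCurlLiouvilleBounded
import Literature.Analysis.FluidPDE.HarmonicLiouvilleGrowth
import Literature.Analysis.FluidPDE.DivFreeVectorPotential
import Summits.NavierStokesRegularity.NavierStokesRegularity.Theorems.ExtremiserTransienceKStarAttainedHalfSpaceVariation
import HarnessLib

/-!
# Crux `ExtremiserTransience.NearExtremalTransience` (stmt-NavierStokesRegularity-21883), line `extremiser_liouville`,
# stub K1b — LIOUVILLE FOR WEAKLY HARMONIC FIELDS OF SUB-CUBIC `L²` GROWTH (the blow-down limits of the residue)

`--supports stmt-NavierStokesRegularity-21883` (helper).  Author: prover seat `ns-el-k1b` (g6).  The tree's Liouville theorem for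
BOUNDED weakly harmonic fields (`exists_ae_eq_const_of_norm_le_of_forall_integral_laplacian_mul_inner_eq_zero`,
`DivCurlLiouvilleBounded`) with boundedness replaced by the GROWTH bound `∫_{B_L}‖w‖² ≤ C L^θ`, `θ < 3`, which is what the
blow-downs `V_R = R(v − c)(R·)` of the K1b residue satisfy (`θ = 1`, slab-energy sandwich): mollify (`φₖ ⋆ ⟪w,a⟫` is harmonic on
`ℝ³` with the same growth, `L²`-contractivity of mollification on `B_{L+1}`), apply the tree's growth Liouville
`HarmonicOnNhd.eq_zero_of_lintegral_sq_le`, and pass to the a.e. limit.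

* `ae_eq_zero_of_weaklyHarmonic_of_growth` : `w ∈ L²_loc(ℝ³;ℝ³)` with `∫⁻_{B_L}‖w‖ₑ² ≤ C·L^θ` (`L ≥ 1`, `θ < 3`) and weakly
  harmonic components ⟹ `w = 0` a.e.

Used by `…ConstantSpeedBlowDownLimit`: a strong `L²_loc` limit of blow-downs of the residue is weakly solenoidal and weakly
irrotational (g6's vorticity law), hence weakly harmonic, hence ZERO.  WHAT THIS IS NOT: K1b is NOT proved; nothing here proves
NS regularity. [folklore]
-/

noncomputable section

open Set Filter Topology MeasureTheory Metric Function ContinuousLinearMap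
open scoped ENNReal NNReal Topology InnerProductSpace RealInnerProductSpace ContDiff Convolution Laplacian
open Literature.Analysis.FluidPDE Literature.Analysis

namespace Summit.NavierStokesRegularity.NavierStokesRegularity.Theorems

-- the problem directory repeats the summit name (`NavierStokesRegularity/NavierStokesRegularity`)
set_option linter.dupNamespace false

namespace ExtremiserLiouville

open DepletionLadder.KStar.HalfSpace (E3)

/-- **Local `L²` bound for mollifications**: for a bump `φ` with `rOut ≤ 1`, a locally square-integrable scalar `g`, and `L > 0`,
`∫⁻_{B_L} ‖φ.normed ⋆ g‖ₑ² ≤ ∫⁻_{B_{L+1}} ‖g‖ₑ²` (on `B_L` the mollification only sees `g` on `B_{L+1}`; `L²`-contractivity).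
[folklore] -/
theorem lintegral_ball_normed_convolution_sq_le (φ : ContDiffBump (0 : E3)) (hφ : φ.rOut ≤ 1) {g : E3 → ℝ}
    (hg : AEStronglyMeasurable g volume) (L : ℝ) :
    ∫⁻ x in ball (0 : E3) L, ‖(φ.normed volume ⋆[lsmul ℝ ℝ, volume] g) x‖ₑ ^ 2 ≤
      ∫⁻ x in ball (0 : E3) (L + 1), ‖g x‖ₑ ^ 2 := by
  set gL : E3 → ℝ := (ball (0 : E3) (L + 1)).indicator g with hgL
  have hgLm : AEStronglyMeasurable gL volume := hg.indicator measurableSet_ball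
  -- on `B_L` the two mollifications agree
  have heq : ∀ x ∈ ball (0 : E3) L, (φ.normed volume ⋆[lsmul ℝ ℝ, volume] g) x = (φ.normed volume ⋆[lsmul ℝ ℝ, volume] gL) x := by
    intro x hx
    rw [convolution_def, convolution_def]
    refine integral_congr_ae (Eventually.of_forall fun t => ?_)
    simp only [lsmul_apply, smul_eq_mul]
    by_cases ht : φ.normed volume t = 0
    · rw [ht, zero_mul, zero_mul]
    · have ht' : t ∈ Function.support (φ.normed volume) := ht
      rw [φ.support_normed_eq, mem_ball_zero_iff] at ht'
      have hxt : x - t ∈ ball (0 : E3) (L + 1) := by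
        rw [mem_ball_zero_iff] at hx ⊢
        calc ‖x - t‖ ≤ ‖x‖ + ‖t‖ := norm_sub_le _ _
          _ < L + 1 := by linarith
      rw [hgL, indicator_of_mem hxt]
  calc ∫⁻ x in ball (0 : E3) L, ‖(φ.normed volume ⋆[lsmul ℝ ℝ, volume] g) x‖ₑ ^ 2
      = ∫⁻ x in ball (0 : E3) L, ‖(φ.normed volume ⋆[lsmul ℝ ℝ, volume] gL) x‖ₑ ^ 2 :=
        setLIntegral_congr_fun measurableSet_ball fun x hx => by rw [heq x hx]
    _ ≤ ∫⁻ x, ‖(φ.normed volume ⋆[lsmul ℝ ℝ, volume] gL) x‖ₑ ^ 2 := setLIntegral_le_lintegral _ _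
    _ = eLpNorm (φ.normed volume ⋆[lsmul ℝ ℝ, volume] gL) 2 volume ^ 2 := (eLpNorm_two_pow_two _).symm
    _ ≤ eLpNorm gL 2 volume ^ 2 := pow_le_pow_left' (FunctionSpaces.eLpNorm_normed_convolution_le φ hgLm (by norm_num)) 2
    _ = ∫⁻ x, ‖gL x‖ₑ ^ 2 := eLpNorm_two_pow_two _
    _ = ∫⁻ x in ball (0 : E3) (L + 1), ‖g x‖ₑ ^ 2 := by
        rw [← lintegral_indicator measurableSet_ball]
        refine lintegral_congr fun x => ?_
        by_cases hx : x ∈ ball (0 : E3) (L + 1)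
        · rw [hgL, indicator_of_mem hx, indicator_of_mem hx]
        · rw [hgL, indicator_of_notMem hx, indicator_of_notMem hx]; simp

/-- **Liouville for weakly harmonic fields of sub-cubic `L²` growth.**  Let `w : ℝ³ → ℝ³` be a.e. strongly measurable with
`∫⁻_{B_L}‖w‖ₑ² ≤ C L^θ` for all `L ≥ 1`, some `θ ∈ [0,3)`, and weakly harmonic components: `∫ (Δϑ)⟪w, a⟫ = 0` for all scalar
test functions `ϑ` and all `a`.  Then `w = 0` a.e. [folklore] -/
theorem ae_eq_zero_of_weaklyHarmonic_of_growth {w : E3 → E3} (hw : AEStronglyMeasurable w volume) {C θ : ℝ} (hC : 0 ≤ C)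
    (hθ0 : 0 ≤ θ) (hθ : θ < 3)
    (hA : ∀ L : ℝ, 1 ≤ L → ∫⁻ x in ball (0 : E3) L, ‖w x‖ₑ ^ 2 ≤ ENNReal.ofReal (C * L ^ θ))
    (hharm : ∀ ϑ : E3 → ℝ, FunctionSpaces.IsTestFunctionOn (⊤ : TopologicalSpace.Opens E3) ϑ → ∀ a : E3,
      ∫ x, (Δ ϑ) x * ⟪w x, a⟫_ℝ = 0) :
    w =ᵐ[volume] 0 := by
  -- local square integrability and local integrability
  have hfin : ∀ R : ℝ, ∫⁻ x in ball (0 : E3) R, ‖w x‖ₑ ^ 2 < ⊤ := by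
    intro R
    have h1 := hA (max R 1) (le_max_right _ _)
    exact lt_of_le_of_lt ((lintegral_mono_set (ball_subset_ball (le_max_left _ _))).trans h1) ENNReal.ofReal_lt_top
  have hwl : LocallyIntegrable w volume := locallyIntegrable_of_lintegral_ball_sq_lt_top hw hfin
  obtain ⟨φ, hφ0, hφ2⟩ := FunctionSpaces.exists_contDiffBump_seq (E := E3)
  have hφ1 : ∀ᶠ k in atTop, (φ k).rOut ≤ 1 := (hφ0.eventually (gt_mem_nhds one_pos)).mono fun k hk => hk.le
  set b := stdOrthonormalBasis ℝ E3
  set v₁ : ℝ := (volume (ball (0 : E3) 1)).toReal with hv₁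
  have hv₁0 : 0 ≤ v₁ := ENNReal.toReal_nonneg
  -- every component vanishes a.e.
  have hcomp : ∀ a : E3, ∀ᵐ y ∂(volume : Measure E3), ⟪w y, a⟫_ℝ = 0 := by
    intro a
    set wa : E3 → ℝ := fun y => ⟪w y, a⟫_ℝ with hwa_def
    have hwam : AEStronglyMeasurable wa volume := hw.inner aestronglyMeasurable_const
    have hwal : LocallyIntegrable wa volume :=
      (hwl.smul ‖a‖).mono hwam (Eventually.of_forall fun x => by
        rw [Pi.smul_apply, norm_smul, norm_norm, Real.norm_eq_abs, mul_comm]; exact abs_real_inner_le_norm (w x) a)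
    -- growth of the component
    have hwaA : ∀ L : ℝ, 1 ≤ L → ∫⁻ x in ball (0 : E3) L, ‖wa x‖ₑ ^ 2 ≤ ENNReal.ofReal (‖a‖ ^ 2 * (C * L ^ θ)) := by
      intro L hL
      have hpt : ∀ x, ‖wa x‖ₑ ^ 2 ≤ ENNReal.ofReal (‖a‖ ^ 2) * ‖w x‖ₑ ^ 2 := by
        intro x
        have h1 : ‖wa x‖ ≤ ‖a‖ * ‖w x‖ := by
          rw [Real.norm_eq_abs, mul_comm]; exact abs_real_inner_le_norm (w x) a
        calc ‖wa x‖ₑ ^ 2 = ENNReal.ofReal (‖wa x‖ ^ 2) := by rw [← ofReal_norm, ENNReal.ofReal_pow (norm_nonneg _)]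
          _ ≤ ENNReal.ofReal ((‖a‖ * ‖w x‖) ^ 2) := ENNReal.ofReal_le_ofReal (pow_le_pow_left₀ (norm_nonneg _) h1 2)
          _ = ENNReal.ofReal (‖a‖ ^ 2) * ‖w x‖ₑ ^ 2 := by
              rw [mul_pow, ENNReal.ofReal_mul (sq_nonneg _), ← ofReal_norm (w x), ENNReal.ofReal_pow (norm_nonneg (w x))]
      calc ∫⁻ x in ball (0 : E3) L, ‖wa x‖ₑ ^ 2 ≤ ∫⁻ x in ball (0 : E3) L, ENNReal.ofReal (‖a‖ ^ 2) * ‖w x‖ₑ ^ 2 :=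
            lintegral_mono fun x => hpt x
        _ = ENNReal.ofReal (‖a‖ ^ 2) * ∫⁻ x in ball (0 : E3) L, ‖w x‖ₑ ^ 2 := by
            rw [lintegral_const_mul' _ _ ENNReal.ofReal_ne_top]
        _ ≤ ENNReal.ofReal (‖a‖ ^ 2) * ENNReal.ofReal (C * L ^ θ) := mul_le_mul' le_rfl (hA L hL)
        _ = ENNReal.ofReal (‖a‖ ^ 2 * (C * L ^ θ)) := by rw [← ENNReal.ofReal_mul (sq_nonneg _)]
    -- each mollification (with `rOut ≤ 1`) is a harmonic function of growth `L^θ`, hence zero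
    have hzero : ∀ᶠ k in atTop, ∀ x, ((φ k).normed volume ⋆[lsmul ℝ ℝ, volume] wa) x = 0 := by
      filter_upwards [hφ1] with k hk
      set ψ : E3 → ℝ := (φ k).normed volume with hψ_def
      have hψ : FunctionSpaces.IsTestFunctionOn (⊤ : TopologicalSpace.Opens E3) ψ := FunctionSpaces.isTestFunctionOn_normed (φ k)
      have hψ2 : ContDiff ℝ 2 ψ := contDiff_infty.1 hψ.contDiff 2
      have hh2 : ContDiff ℝ 2 (ψ ⋆[lsmul ℝ ℝ, volume] wa) := hψ.hasCompactSupport.contDiff_convolution_left _ hψ2 hwal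
      have hΔ : ∀ x, Δ (ψ ⋆[lsmul ℝ ℝ, volume] wa) x = 0 := by
        intro x
        rw [laplacian_convolution_lsmul hψ2 hψ.hasCompactSupport hwal x, convolution_def]
        simp only [lsmul_apply, smul_eq_mul]
        have e := integral_sub_left_eq_self (fun t => (Δ ψ) t * wa (x - t)) volume x
        simp only [sub_sub_cancel] at e
        rw [← e]
        have hθ' : FunctionSpaces.IsTestFunctionOn (⊤ : TopologicalSpace.Opens E3) (fun z => ψ (x - z)) := hψ.comp_sub_left x
        have key := hharm _ hθ' a
        simp_rw [laplacian_comp_sub_left hψ2 x] at key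
        exact key
      have hharm' : InnerProductSpace.HarmonicOnNhd (ψ ⋆[lsmul ℝ ℝ, volume] wa) univ := fun x _ =>
        ⟨hh2.contDiffAt, Eventually.of_forall fun y => hΔ y⟩
      -- growth: large balls by `L²`-contractivity, small balls by continuity
      have hcont : Continuous (ψ ⋆[lsmul ℝ ℝ, volume] wa) := hh2.continuous
      obtain ⟨K, hK⟩ := (isCompact_closedBall (0 : E3) 1).exists_bound_of_continuousOn hcont.continuousOn
      have hK0 : 0 ≤ K := (norm_nonneg _).trans (hK 0 (mem_closedBall_self zero_le_one))
      set Cbig : ℝ≥0∞ := ENNReal.ofReal (‖a‖ ^ 2 * C * (2 : ℝ) ^ θ) + ENNReal.ofReal (K ^ 2 * v₁) with hCbig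
      have hgrowth : ∀ L : ℝ, 0 < L →
          ∫⁻ x in ball (0 : E3) L, ‖(ψ ⋆[lsmul ℝ ℝ, volume] wa) x‖ₑ ^ 2 ≤ Cbig * ENNReal.ofReal (L ^ θ) := by
        intro L hL
        rcases le_or_gt 1 L with hL1 | hL1
        · -- `L ≥ 1`
          have h1 := lintegral_ball_normed_convolution_sq_le (φ k) hk hwam L
          have h2 := hwaA (L + 1) (by linarith)
          have h3 : ENNReal.ofReal (‖a‖ ^ 2 * (C * (L + 1) ^ θ)) ≤ ENNReal.ofReal (‖a‖ ^ 2 * C * (2 : ℝ) ^ θ) * ENNReal.ofReal (L ^ θ) := by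
            rw [← ENNReal.ofReal_mul (by positivity)]
            refine ENNReal.ofReal_le_ofReal ?_
            have hpow : (L + 1) ^ θ ≤ (2 : ℝ) ^ θ * L ^ θ := by
              rw [← Real.mul_rpow (by norm_num) hL.le]
              exact Real.rpow_le_rpow (by linarith) (by linarith) hθ0
            have : 0 ≤ ‖a‖ ^ 2 * C := by positivity
            nlinarith [mul_le_mul_of_nonneg_left hpow this]
          calc _ ≤ ∫⁻ x in ball (0 : E3) (L + 1), ‖wa x‖ₑ ^ 2 := h1
            _ ≤ ENNReal.ofReal (‖a‖ ^ 2 * (C * (L + 1) ^ θ)) := h2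
            _ ≤ ENNReal.ofReal (‖a‖ ^ 2 * C * (2 : ℝ) ^ θ) * ENNReal.ofReal (L ^ θ) := h3
            _ ≤ Cbig * ENNReal.ofReal (L ^ θ) := mul_le_mul' le_self_add le_rfl
        · -- `L < 1`: sup bound on the unit ball
          have hpt : ∀ x ∈ ball (0 : E3) L, ‖(ψ ⋆[lsmul ℝ ℝ, volume] wa) x‖ₑ ^ 2 ≤ ENNReal.ofReal (K ^ 2) := by
            intro x hx
            have hx1 : x ∈ closedBall (0 : E3) 1 := by
              rw [mem_closedBall, dist_zero_right]; rw [mem_ball_zero_iff] at hx; linarith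
            rw [← ofReal_norm, ← ENNReal.ofReal_pow (norm_nonneg _)]
            exact ENNReal.ofReal_le_ofReal (pow_le_pow_left₀ (norm_nonneg _) (hK x hx1) 2)
          have hvol : volume (ball (0 : E3) L) = ENNReal.ofReal (L ^ 3 * v₁) := by
            rw [Measure.addHaar_ball volume (0 : E3) hL.le, finrank_euclideanSpace, Fintype.card_fin, hv₁,
              ENNReal.ofReal_mul (by positivity), ENNReal.ofReal_toReal measure_ball_lt_top.ne]
          have hL3 : L ^ 3 ≤ L ^ θ := by
            have h := Real.rpow_le_rpow_of_exponent_ge hL hL1.le hθ.le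
            rwa [show L ^ (3 : ℝ) = L ^ 3 by exact_mod_cast Real.rpow_natCast L 3] at h
          calc ∫⁻ x in ball (0 : E3) L, ‖(ψ ⋆[lsmul ℝ ℝ, volume] wa) x‖ₑ ^ 2
              ≤ ∫⁻ x in ball (0 : E3) L, ENNReal.ofReal (K ^ 2) := setLIntegral_mono measurable_const hpt
            _ = ENNReal.ofReal (K ^ 2) * volume (ball (0 : E3) L) := setLIntegral_const _ _
            _ = ENNReal.ofReal (K ^ 2 * v₁) * ENNReal.ofReal (L ^ 3) := by
                rw [hvol, ← ENNReal.ofReal_mul (sq_nonneg _), ← ENNReal.ofReal_mul (by positivity)]; ring_nf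
            _ ≤ ENNReal.ofReal (K ^ 2 * v₁) * ENNReal.ofReal (L ^ θ) := mul_le_mul' le_rfl (ENNReal.ofReal_le_ofReal hL3)
            _ ≤ Cbig * ENNReal.ofReal (L ^ θ) := mul_le_mul' le_add_self le_rfl
      have hfinr : Module.finrank ℝ E3 = 3 := by rw [finrank_euclideanSpace, Fintype.card_fin]
      have hθ' : θ < Module.finrank ℝ E3 := by rw [hfinr]; exact_mod_cast hθ
      intro x
      exact hharm'.eq_zero_of_lintegral_sq_le (by rw [hCbig]; exact ENNReal.add_ne_top.2 ⟨ENNReal.ofReal_ne_top, ENNReal.ofReal_ne_top⟩)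
        hθ' hgrowth x
    -- the mollifications converge to `wa` a.e.
    have hlim := FunctionSpaces.ae_tendsto_normed_convolution hφ0 hφ2 hwal
    filter_upwards [hlim] with x hx
    have h0 : Tendsto (fun k => ((φ k).normed volume ⋆[lsmul ℝ ℝ, volume] wa) x) atTop (𝓝 0) :=
      tendsto_const_nhds.congr' (hzero.mono fun k hk => (hk x).symm)
    exact tendsto_nhds_unique hx h0
  -- assemble along an orthonormal frame
  have hall : ∀ᵐ y ∂(volume : Measure E3), ∀ i, ⟪w y, b i⟫_ℝ = 0 := ae_all_iff.2 fun i => hcomp (b i)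
  filter_upwards [hall] with y hy
  show w y = 0
  rw [← b.sum_repr' (w y)]
  exact Finset.sum_eq_zero fun i _ => by rw [real_inner_comm, hy i, zero_smul]

end ExtremiserLiouville

end Summit.NavierStokesRegularity.NavierStokesRegularity.Theorems

end
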